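import Mathlib.Combinatorics.SetFamily.Compression.Down
import Mathlib.Tactic
import HarnessLib
import HarnessLib.Audit.Tags
import Summits.CriticalPhenomena.PercolationContinuityZ3.Theorems.PercNearOneGluingNoHeavyLowerTailSahiRainbowTwoColourDeficitS2a

/-!
# The sparse residual is LOCAL, VI: three D-points; points with singleton members (QQ, DDG, DQ)

Support file (seat `prim-masterthm-p1`, gen 42; `--supports stmt-CriticalPhenomena-4575`).  No `sorry`, standard axioms.
Blueprint `run/shared/lean/prim/prim-masterthm/FROM-prim-masterthm-p1-g42-*.md` (PROOFS §4–§5).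

SETTING (`…SahiRainbowTwoColourDeficitDefs`): `Z = K ⊔ K' ⊆ 2^G` complement-closed (colour classes in either order),
`L = monoMeets K K'`; monochromatic bisections `Bisect C Z G y A A'` (`A, A' ∈ C`, `A ∩ A' = {y}`, `A ∪ A' = G`, lower
members in `Z`); D-points `DAt` (a `K`- and a `K'`-bisection, `{y} ∈ L`, no non-empty twin) and Q-points `Q3At K K'`
(`{y} ∈ K`, `G ∈ K'`, `G ∖ y ∈ Z`, a `K`-bisection, no non-empty twin).

THIS FILE (S₂ versus S₂, second half):
* `DAt.false_of_three` (**D³**): three D-points cannot coexist when `G` has a fourth point (`d3_core`: DD at `(y₁,y₂)` and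
  at `(y₁,y₃)` force `A = G`, `B' = {{y₁,y₃}}`);
* `Bisect.qq` (**QQ**, `G ∈ K'`): two points with `K`-bisections sharing `C` and `G ∖ y_i ∈ Z` have `C = {{y₁, y₂}}`; hence
  `Bisect.false_of_three_qq`: three such points cannot coexist when `G` has a fourth point;
* `DAt.singleton_mem_of_pair` (**DDG**, `G ∈ K'`): two D-points force `{{y₁}} ∈ K'`; `DAt.false_of_Q3At` (**DQ**): a D-point
  without singleton member and a Q-point cannot coexist.
HONEST FRAMING: unconditional combinatorial lemmas (the local three-direction analysis of the sparse residual). [this work]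
-/

namespace Summit.CriticalPhenomena.PercolationContinuityZ3.Theorems.SahiColouredDaykin

open Finset
open scoped FinsetFamily

variable {α : Type*} [DecidableEq α]

/-! ### 3. Three D-points -/

section DDD

variable {K K' : Finset (Finset α)} {G : Finset α}

/-- Re-orient a bisection so that its first member contains a given point of `G`. [this work] -/
theorem Bisect.select {C Z : Finset (Finset α)} {y : α} {A A' : Finset α} (h : Bisect C Z G y A A') {t : α}
    (htG : t ∈ G) : ∃ V V', Bisect C Z G y V V' ∧ t ∈ V := by
  by_cases ht : t ∈ A
  · exact ⟨A, A', h, ht⟩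
  · exact ⟨A', A, h.swap, h.mem'_iff.2 (Or.inr ⟨htG, ht⟩)⟩

/-- D³ core: the structure `S` at `(y₁, y₂)` with `y₃ ∈ A`, and a D-point at `y₃`: absurd (given a fourth point).
[this work] -/
theorem d3_core (hKK' : Disjoint K K') {y₁ y₂ y₃ : α} {A A' B B' A₃ A₃' B₃ B₃' : Finset α}
    (hA : Bisect K (K ∪ K') G y₁ A A') (hB : Bisect K' (K ∪ K') G y₁ B B') (hS : A ∩ B = {y₁, y₂} ∧ A ∪ B = G)
    (hy₃A : y₃ ∈ A) (h13 : y₁ ≠ y₃) (h23 : y₂ ≠ y₃) (hA₃ : Bisect K (K ∪ K') G y₃ A₃ A₃')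
    (hB₃ : Bisect K' (K ∪ K') G y₃ B₃ B₃') (htw₁ : NoTwin (monoMeets K K') y₁) (htw₃ : NoTwin (monoMeets K K') y₃)
    (hG4 : ∃ t ∈ G, t ≠ y₁ ∧ t ≠ y₂ ∧ t ≠ y₃) : False := by
  have hy₁G : y₁ ∈ G := hA.y_mem_G
  have hy₃B : y₃ ∉ B := by
    intro h
    have : y₃ ∈ A ∩ B := mem_inter.2 ⟨hy₃A, h⟩
    rw [hS.1, mem_insert, mem_singleton] at this
    rcases this with h | h
    · exact h13 h.symm
    · exact h23 h.symm
  have hy₃B' : y₃ ∈ B' := hB.mem'_iff.2 (Or.inr ⟨hA.subset hy₃A, hy₃B⟩)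
  have htw₁' : NoTwin (monoMeets K' K) y₁ := by rw [monoMeets_comm]; exact htw₁
  have htw₃' : NoTwin (monoMeets K' K) y₃ := by rw [monoMeets_comm]; exact htw₃
  have e := union_comm K K'
  -- shared members with the bisections at `y₃`
  obtain ⟨V, V', hV, hy₁V⟩ := hA₃.select hy₁G
  obtain ⟨W, W', hW, hy₁W⟩ := hB₃.select hy₁G
  have hAV : A = V := hA.shared hV h13 hy₃A hy₁V htw₁ htw₃
  have hBW : B' = W := Bisect.shared (K := K') (K' := K) (hB.swap.of_eq e) (hW.of_eq e) h13 hy₃B' hy₁W htw₁' htw₃'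
  subst hAV; subst hBW
  obtain ⟨hS1, hS2⟩ := Bisect.dd hKK' hA hV hB.swap hW h13 htw₁ htw₃
  -- `B' ⊆ A`, so `A = G` and `B' = {y₁, y₃}`; the fourth point has nowhere to go
  obtain ⟨t, htG, ht1, ht2, ht3⟩ := hG4
  have htA : t ∈ A := by
    have := hS2 ▸ htG
    rcases mem_union.1 this with h | h
    · exact h
    · rcases (hB.mem'_iff).1 h with h | h
      · exact absurd h ht1
      · have := hS.2 ▸ h.1
        rcases mem_union.1 this with h' | h'
        · exact h'
        · exact absurd h' h.2
  have htB : t ∉ B := by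
    intro h
    have : t ∈ A ∩ B := mem_inter.2 ⟨htA, h⟩
    rw [hS.1, mem_insert, mem_singleton] at this
    rcases this with h | h
    · exact ht1 h
    · exact ht2 h
  have htB' : t ∈ B' := hB.mem'_iff.2 (Or.inr ⟨htG, htB⟩)
  have : t ∈ A ∩ B' := mem_inter.2 ⟨htA, htB'⟩
  rw [hS1, mem_insert, mem_singleton] at this
  rcases this with h | h
  · exact ht1 h
  · exact ht3 h

/-- **THREE D-POINTS CANNOT COEXIST** (given a fourth point of `G`). [this work] -/
theorem DAt.false_of_three (hKK' : Disjoint K K') {y₁ y₂ y₃ : α} {A₁ A₁' B₁ B₁' A₂ A₂' B₂ B₂' A₃ A₃' B₃ B₃' : Finset α}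
    (h₁ : DAt K K' G y₁ A₁ A₁' B₁ B₁') (h₂ : DAt K K' G y₂ A₂ A₂' B₂ B₂') (h₃ : DAt K K' G y₃ A₃ A₃' B₃ B₃')
    (h12 : y₁ ≠ y₂) (h13 : y₁ ≠ y₃) (h23 : y₂ ≠ y₃) (hG4 : ∃ t ∈ G, t ≠ y₁ ∧ t ≠ y₂ ∧ t ≠ y₃) : False := by
  have hy₁G : y₁ ∈ G := h₁.bisX.y_mem_G
  have hy₂G : y₂ ∈ G := h₂.bisX.y_mem_G
  have hy₃G : y₃ ∈ G := h₃.bisX.y_mem_G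
  have e := union_comm K K'
  have tw' : ∀ {y : α}, NoTwin (monoMeets K K') y → NoTwin (monoMeets K' K) y := by
    intro y h; rw [monoMeets_comm]; exact h
  -- shared members for the pair `(y₁, y₂)`
  obtain ⟨A, A', hA, hy₂A⟩ := h₁.bisX.select hy₂G
  obtain ⟨V, V', hV, hy₁V⟩ := h₂.bisX.select hy₁G
  obtain ⟨B, B', hB, hy₂B⟩ := h₁.bisY.select hy₂G
  obtain ⟨W, W', hW, hy₁W⟩ := h₂.bisY.select hy₁G
  have hAV : A = V := hA.shared hV h12 hy₂A hy₁V h₁.noTwin h₂.noTwin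
  have hBW : B = W :=
    Bisect.shared (K := K') (K' := K) (hB.of_eq e) (hW.of_eq e) h12 hy₂B hy₁W (tw' h₁.noTwin) (tw' h₂.noTwin)
  subst hAV; subst hBW
  have hS := Bisect.dd hKK' hA hV hB hW h12 h₁.noTwin h₂.noTwin
  by_cases hy₃A : y₃ ∈ A
  · exact d3_core hKK' hA hB hS hy₃A h13 h23 h₃.bisX h₃.bisY h₁.noTwin h₃.noTwin hG4
  · have hy₃B : y₃ ∈ B := by
      have := hS.2 ▸ hy₃G
      rcases mem_union.1 this with h | h
      · exact absurd h hy₃A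
      · exact h
    have hS' : B ∩ A = {y₁, y₂} ∧ B ∪ A = G := by rw [inter_comm, union_comm]; exact hS
    exact d3_core hKK'.symm (hB.of_eq e) (hA.of_eq e) hS' hy₃B h13 h23 (h₃.bisY.of_eq e) (h₃.bisX.of_eq e)
      (tw' h₁.noTwin) (tw' h₃.noTwin) hG4

end DDD

/-! ### 4. Points with a singleton member, when `∅ ∈ Z` (say `G ∈ K'`) -/

section QQ

variable {K K' : Finset (Finset α)} {G : Finset α}

/-- **QQ.**  `G ∈ K'`, `G ∖ y₁, G ∖ y₂ ∈ Z`, and `K`-bisections at `y₁ ≠ y₂` sharing the member `C`: then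
`C = {y₁, y₂}` (given a third point of `G`). [this work] -/
theorem Bisect.qq (hKK' : Disjoint K K') {y₁ y₂ : α} {C D₁ D₂ : Finset α} (hGK' : G ∈ K')
    (hG₁ : G.erase y₁ ∈ K ∪ K') (hG₂ : G.erase y₂ ∈ K ∪ K') (hC₁ : Bisect K (K ∪ K') G y₁ C D₁)
    (hC₂ : Bisect K (K ∪ K') G y₂ C D₂) (hne : y₁ ≠ y₂) (htw₁ : NoTwin (monoMeets K K') y₁)
    (htw₂ : NoTwin (monoMeets K K') y₂) (hG3 : ∃ t ∈ G, t ≠ y₁ ∧ t ≠ y₂) : C = {y₁, y₂} := by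
  have hy₁C := hC₁.y_mem; have hy₂C := hC₂.y_mem
  have hCG : C ≠ G := fun e => disjoint_left.1 hKK' hC₁.mem (e ▸ hGK')
  have sC_ne : (G \ C).Nonempty := by
    rw [nonempty_iff_ne_empty]; intro h
    exact hCG (Subset.antisymm hC₁.subset (sdiff_eq_empty_iff_subset.1 h))
  have hy₁sC : y₁ ∉ G \ C := fun h => (mem_sdiff.1 h).2 hy₁C
  have hy₂sC : y₂ ∉ G \ C := fun h => (mem_sdiff.1 h).2 hy₂C
  have hD₁ := hC₁.eq_insert_sdiff; have hD₂ := hC₂.eq_insert_sdiff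
  have hy₁D₂ : y₁ ∉ D₂ := by
    rw [hD₂, mem_insert]; rintro (h | h); exacts [hne h, hy₁sC h]
  have hy₂D₁ : y₂ ∉ D₁ := by
    rw [hD₁, mem_insert]; rintro (h | h); exacts [hne h.symm, hy₂sC h]
  have hD12 : D₁ ≠ D₂ := fun e => hy₁D₂ (e ▸ hC₁.y_mem')
  have sC_mem : G \ C ∈ monoMeets K K' := by
    have := inter_mem_monoMeets_left (Y := K') hC₁.mem' hC₂.mem' hD12
    rwa [hD₁, hD₂, insert_inter_of_notMem (hD₂ ▸ hy₁D₂ : y₁ ∉ insert y₂ (G \ C)), inter_insert_of_notMem hy₂sC,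
      inter_self] at this
  -- the one-sided argument: `G ∖ y ∈ K` forces the conclusion (or a twin at the other point)
  have side : ∀ {y y' : α} {D D' : Finset α}, Bisect K (K ∪ K') G y C D → Bisect K (K ∪ K') G y' C D' → y ≠ y' →
      y ∉ D' → G.erase y ∈ K → NoTwin (monoMeets K K') y' → C = {y, y'} := by
    intro y y' D D' hD hD' hyy' hyD' hGy htw'
    have hD'e := hD'.eq_insert_sdiff
    by_cases hDG : D' = G.erase y
    · ext t; simp only [mem_insert, mem_singleton]
      constructor
      · intro htC
        by_contra h; push Not at h
        have : t ∈ G.erase y := mem_erase.2 ⟨h.1, hD.subset htC⟩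
        rw [← hDG, hD'e, mem_insert, mem_sdiff] at this
        rcases this with h' | h'
        · exact h.2 h'
        · exact h'.2 htC
      · rintro (rfl | rfl); exacts [hD.y_mem, hD'.y_mem]
    · exfalso
      have c'_mem := inter_mem_monoMeets_left (Y := K') hD'.mem' hGy hDG
      have hsub : D' ⊆ G.erase y := fun t ht => mem_erase.2 ⟨fun h => hyD' (h ▸ ht), hD'.swap.subset ht⟩
      rw [inter_eq_left.2 hsub, hD'e] at c'_mem
      exact htw'.elim sC_mem c'_mem (fun h => (mem_sdiff.1 h).2 hD'.y_mem) sC_ne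
  rcases mem_union.1 hG₁ with h1K | h1K'
  · exact side hC₁ hC₂ hne hy₁D₂ h1K htw₂
  rcases mem_union.1 hG₂ with h2K | h2K'
  · rw [pair_comm]; exact side hC₂ hC₁ hne.symm hy₂D₁ h2K htw₁
  -- both `G ∖ y_i ∈ K'`: twin `G ∖ {y₁, y₂}` at `y₁`
  exfalso
  have ne1 : G.erase y₁ ≠ G.erase y₂ := by
    intro h; have : y₂ ∈ G.erase y₁ := mem_erase.2 ⟨hne.symm, hC₂.y_mem_G⟩
    rw [h] at this; exact (notMem_erase _ _) this
  have ne2 : G ≠ G.erase y₂ := fun h => (notMem_erase y₂ G) (h ▸ hC₂.y_mem_G)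
  have c_mem := inter_mem_monoMeets_right (X := K) h1K' h2K' ne1
  have c'_mem := inter_mem_monoMeets_right (X := K) hGK' h2K' ne2
  rw [inter_eq_right.2 (erase_subset _ _)] at c'_mem
  have e1 : G.erase y₁ ∩ G.erase y₂ = (G.erase y₂).erase y₁ := by
    rw [inter_comm, inter_erase, inter_eq_left.2 (erase_subset _ _)]
  rw [e1] at c_mem
  rw [← insert_erase (mem_erase.2 ⟨hne, hC₁.y_mem_G⟩ : y₁ ∈ G.erase y₂)] at c'_mem
  have hc := htw₁ c_mem c'_mem (notMem_erase _ _)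
  obtain ⟨t, htG, ht1, ht2⟩ := hG3
  have : t ∈ (G.erase y₂).erase y₁ := mem_erase.2 ⟨ht1, mem_erase.2 ⟨ht2, htG⟩⟩
  rw [hc] at this; exact notMem_empty _ this

/-- **Three points with `K`-bisections and `G ∖ y_i ∈ Z` (when `G ∈ K'`) cannot coexist** (given a fourth point).
[this work] -/
theorem Bisect.false_of_three_qq (hKK' : Disjoint K K') (hGK' : G ∈ K') {y₁ y₂ y₃ : α}
    {C₁ C₁' C₂ C₂' C₃ C₃' : Finset α} (hG₁ : G.erase y₁ ∈ K ∪ K') (hG₂ : G.erase y₂ ∈ K ∪ K')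
    (hG₃ : G.erase y₃ ∈ K ∪ K') (hC₁ : Bisect K (K ∪ K') G y₁ C₁ C₁') (hC₂ : Bisect K (K ∪ K') G y₂ C₂ C₂')
    (hC₃ : Bisect K (K ∪ K') G y₃ C₃ C₃') (htw₁ : NoTwin (monoMeets K K') y₁) (htw₂ : NoTwin (monoMeets K K') y₂)
    (htw₃ : NoTwin (monoMeets K K') y₃) (h12 : y₁ ≠ y₂) (h13 : y₁ ≠ y₃) (h23 : y₂ ≠ y₃)
    (hG4 : ∃ t ∈ G, t ≠ y₁ ∧ t ≠ y₂ ∧ t ≠ y₃) : False := by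
  have hy₁G := hC₁.y_mem_G; have hy₂G := hC₂.y_mem_G; have hy₃G := hC₃.y_mem_G
  have g12 : ∃ t ∈ G, t ≠ y₁ ∧ t ≠ y₂ := ⟨y₃, hy₃G, h13.symm, h23.symm⟩
  have g13 : ∃ t ∈ G, t ≠ y₁ ∧ t ≠ y₃ := ⟨y₂, hy₂G, h12.symm, h23⟩
  -- the member at `y₁` through `y₂` is `{y₁, y₂}`, the member through `y₃` is `{y₁, y₃}`
  have two : ∀ {y : α} {V V' C C' : Finset α}, Bisect K (K ∪ K') G y₁ V V' → y ∈ V → Bisect K (K ∪ K') G y C C' →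
      y₁ ≠ y → G.erase y ∈ K ∪ K' → NoTwin (monoMeets K K') y → (∃ t ∈ G, t ≠ y₁ ∧ t ≠ y) → V = {y₁, y} := by
    intro y V V' C C' hV hyV hC hy hGy htw hg
    obtain ⟨W, W', hW, hy₁W⟩ := hC.select hy₁G
    have := hV.shared hW hy hyV hy₁W htw₁ htw
    subst this
    exact Bisect.qq hKK' hGK' hG₁ hGy hV hW hy htw₁ htw hg
  obtain ⟨t, htG, ht1, ht2, ht3⟩ := hG4
  by_cases m2 : y₂ ∈ C₁ <;> by_cases m3 : y₃ ∈ C₁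
  · have e2 := two hC₁ m2 hC₂ h12 hG₂ htw₂ g12
    have e3 := two hC₁ m3 hC₃ h13 hG₃ htw₃ g13
    have : y₃ ∈ ({y₁, y₂} : Finset α) := e2 ▸ m3
    rw [mem_insert, mem_singleton] at this
    rcases this with h | h; exacts [h13 h.symm, h23 h.symm]
  · have m3' : y₃ ∈ C₁' := hC₁.mem'_iff.2 (Or.inr ⟨hy₃G, m3⟩)
    have e2 := two hC₁ m2 hC₂ h12 hG₂ htw₂ g12
    have e3 := two hC₁.swap m3' hC₃ h13 hG₃ htw₃ g13
    have := hC₁.union_eq ▸ htG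
    rw [e2, e3] at this
    simp only [mem_union, mem_insert, mem_singleton] at this
    rcases this with (h | h) | (h | h); exacts [ht1 h, ht2 h, ht1 h, ht3 h]
  · have m2' : y₂ ∈ C₁' := hC₁.mem'_iff.2 (Or.inr ⟨hy₂G, m2⟩)
    have e2 := two hC₁.swap m2' hC₂ h12 hG₂ htw₂ g12
    have e3 := two hC₁ m3 hC₃ h13 hG₃ htw₃ g13
    have := hC₁.union_eq ▸ htG
    rw [e2, e3] at this
    simp only [mem_union, mem_insert, mem_singleton] at this
    rcases this with (h | h) | (h | h); exacts [ht1 h, ht3 h, ht1 h, ht2 h]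
  · have m2' : y₂ ∈ C₁' := hC₁.mem'_iff.2 (Or.inr ⟨hy₂G, m2⟩)
    have m3' : y₃ ∈ C₁' := hC₁.mem'_iff.2 (Or.inr ⟨hy₃G, m3⟩)
    have e2 := two hC₁.swap m2' hC₂ h12 hG₂ htw₂ g12
    have e3 := two hC₁.swap m3' hC₃ h13 hG₃ htw₃ g13
    have : y₃ ∈ ({y₁, y₂} : Finset α) := e2 ▸ m3'
    rw [mem_insert, mem_singleton] at this
    rcases this with h | h; exacts [h13 h.symm, h23 h.symm]

/-- **DDG.**  If `G ∈ K'`, two D-points force `{y₁} ∈ K'` (the shared `K'`-member must be `G`). [this work] -/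
theorem DAt.singleton_mem_of_pair (hGK' : G ∈ K') {y₁ y₂ : α} {A₁ A₁' B₁ B₁' A₂ A₂' B₂ B₂' : Finset α}
    (h₁ : DAt K K' G y₁ A₁ A₁' B₁ B₁') (h₂ : DAt K K' G y₂ A₂ A₂' B₂ B₂') (hne : y₁ ≠ y₂) : {y₁} ∈ K' := by
  have hy₁G : y₁ ∈ G := h₁.bisX.y_mem_G
  have hy₂G : y₂ ∈ G := h₂.bisX.y_mem_G
  have e := union_comm K K'
  obtain ⟨B, B', hB, hy₂B⟩ := h₁.bisY.select hy₂G
  obtain ⟨W, W', hW, hy₁W⟩ := h₂.bisY.select hy₁G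
  have htw₁' : NoTwin (monoMeets K' K) y₁ := by rw [monoMeets_comm]; exact h₁.noTwin
  have htw₂' : NoTwin (monoMeets K' K) y₂ := by rw [monoMeets_comm]; exact h₂.noTwin
  have hBW : B = W := Bisect.shared (K := K') (K' := K) (hB.of_eq e) (hW.of_eq e) hne hy₂B hy₁W htw₁' htw₂'
  subst hBW
  have hB'e := hB.eq_insert_sdiff; have hW'e := hW.eq_insert_sdiff
  have hy₁W' : y₁ ∉ W' := by
    rw [hW.mem'_iff]; rintro (h | h); exacts [hne h, h.2 hB.y_mem]
  have neW'G : W' ≠ G := fun h => hy₁W' (h ▸ hy₁G)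
  have neB'W' : B' ≠ W' := fun h => hy₁W' (h ▸ hB.y_mem')
  have c'_mem := inter_mem_monoMeets_right (X := K) hW.mem' hGK' neW'G
  rw [inter_eq_left.2 hW.swap.subset, hW'e] at c'_mem
  have c_mem := inter_mem_monoMeets_right (X := K) hB.mem' hW.mem' neB'W'
  rw [hB'e, hW'e, insert_inter_of_notMem, inter_insert_of_notMem (fun h => (mem_sdiff.1 h).2 hW.y_mem),
    inter_self] at c_mem
  swap
  · rw [mem_insert]; rintro (h | h); exacts [hne h, (mem_sdiff.1 h).2 hB.y_mem]
  have hc := h₂.noTwin c_mem c'_mem (fun h => (mem_sdiff.1 h).2 hW.y_mem)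
  have : B' = {y₁} := by rw [hB'e, hc, insert_empty]
  exact this ▸ hB.mem'

/-- **DQ.**  If `G ∈ K'`: a D-point `y₁` with `{y₁} ∉ Z` and a Q-point `y₂` (`{y₂} ∈ K`) cannot coexist. [this work] -/
theorem DAt.false_of_Q3At (hKK' : Disjoint K K') {y₁ y₂ : α} {A₁ A₁' B₁ B₁' C C' : Finset α}
    (h₁ : DAt K K' G y₁ A₁ A₁' B₁ B₁') (hs₁ : {y₁} ∉ K ∪ K') (h₂ : Q3At K K' G y₂ C C') (hne : y₁ ≠ y₂) :
    False := by
  have hy₁G : y₁ ∈ G := h₁.bisX.y_mem_G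
  have hy₂G : y₂ ∈ G := h₂.bis.y_mem_G
  have hGK' := h₂.univ_mem
  obtain ⟨A, A', hA, hy₂A⟩ := h₁.bisX.select hy₂G
  obtain ⟨V, V', hV, hy₁V⟩ := h₂.bis.select hy₁G
  obtain ⟨B, B', hB, hy₂B⟩ := h₁.bisY.select hy₂G
  have hAV : A = V := hA.shared hV hne hy₂A hy₁V h₁.noTwin h₂.noTwin
  subst hAV
  -- `B ≠ G` since `{y₁} ∉ Z`
  have hBG : B ≠ G := by
    intro h
    have : B' = {y₁} := by rw [hB.eq_insert_sdiff, h, Finset.sdiff_self, insert_empty]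
    exact hs₁ (mem_union_right _ (this ▸ hB.mem'))
  have B_mem : B ∈ monoMeets K K' := by
    have := inter_mem_monoMeets_right (X := K) hB.mem hGK' hBG
    rwa [inter_eq_left.2 hB.subset] at this
  rcases mem_union.1 h₂.erase_univ_mem with hK | hK'
  · -- `G ∖ y₂ ∈ K`: the colours `G ∖ A` and `insert y₁ (G ∖ A)` form a twin at `y₁`
    by_cases hA'e : A' = G.erase y₂
    · apply hs₁
      have hAeq : A = insert y₁ {y₂} := by
        rw [hA.swap.eq_insert_sdiff, hA'e, sdiff_erase hy₂G, Finset.sdiff_self, insert_empty]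
      have := hV.erase_mem
      rwa [hAeq, erase_insert_of_ne hne, erase_singleton, insert_empty] at this
    have hy₂A' : y₂ ∉ A' := by
      rw [hA.mem'_iff]; rintro (h | h); exacts [hne h.symm, h.2 hy₂A]
    have c'_mem := inter_mem_monoMeets_left (Y := K') hA.mem' hK hA'e
    have hsub : A' ⊆ G.erase y₂ := by
      intro t ht
      exact mem_erase.2 ⟨fun h => hy₂A' (by rw [← h]; exact ht), hA.swap.subset ht⟩
    rw [inter_eq_left.2 hsub, hA.eq_insert_sdiff] at c'_mem
    have neV' : V' ≠ G.erase y₂ := fun h => (notMem_erase y₂ G) (h ▸ hV.y_mem')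
    have c_mem := inter_mem_monoMeets_left (Y := K') hV.mem' hK neV'
    rw [hV.eq_insert_sdiff, insert_inter_of_notMem (notMem_erase _ _),
      inter_eq_left.2 (fun t ht => mem_erase.2 ⟨fun h => (mem_sdiff.1 ht).2 (h ▸ hy₂A), (mem_sdiff.1 ht).1⟩)]
      at c_mem
    have hc := h₁.noTwin c_mem c'_mem (fun h => (mem_sdiff.1 h).2 hA.y_mem)
    have hAG : A = G := Subset.antisymm hA.subset (sdiff_eq_empty_iff_subset.1 hc)
    exact disjoint_left.1 hKK' hA.mem (hAG ▸ hGK')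
  · -- `G ∖ y₂ ∈ K'`: twin `B ∖ y₂` at `y₂`
    have ne : B ≠ G.erase y₂ := fun h => (notMem_erase y₂ G) (h ▸ hy₂B)
    have c_mem := inter_mem_monoMeets_right (X := K) hB.mem hK' ne
    rw [inter_erase, inter_eq_left.2 hB.subset] at c_mem
    rw [← insert_erase hy₂B] at B_mem
    have hc := h₂.noTwin c_mem B_mem (notMem_erase _ _)
    have : y₁ ∈ B.erase y₂ := mem_erase.2 ⟨hne, hB.y_mem⟩
    rw [hc] at this; exact notMem_empty _ this

end QQ
end Summit.CriticalPhenomena.PercolationContinuityZ3.Theorems.SahiColouredDaykin
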